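import Literature.ModelTheory.ExponentialFields.Wilkie1996Induction
import Mathlib.LinearAlgebra.Dimension.Constructions
import Mathlib.LinearAlgebra.Dimension.Finite
import HarnessLib

/-!
# Wilkie 1996, §§10–11: Lemma 9.3 from the valuation inequality alone

Topic `Literature/ModelTheory/ExponentialFields`.  After `Wilkie1996Induction.lean`, the only
unproved ingredient under Wilkie's theorem (`wilkie_isModelComplete`, and the leaf
`Wilkie1996_expPolynomialPoints_bounded`) in this tree is **9.3** of A. J. Wilkie, J. Amer.
Math. Soc. 9 (1996), §9, p. 1084, taken there as the inline hypothesis `h93`: for models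
`k ⊆ K` of `T_exp`, if `ᾱ ∈ Kⁿ` is a non-singular zero of a square system from Wilkie's ring
`Mˢₙ`, `l ∈ s` and `|α_l| > k`, then `0 < c + Σ_{i ∈ s} nᵢ αᵢ < 1` for some integers `nᵢ`
(`i ∈ s`), not all zero, and some `c ∈ k` (den Besten 2016, condition (36)).  Wilkie proves 9.3
in §§10–11 from two ingredients of a different nature:

* **(V) the valuation inequality** `valdim ≤ dim` for the (smooth, o-minimal, model complete)
  theory `T_e`, `e(x) = exp((1 + x²)⁻¹)` (Wilkie §10; den Besten Theorems 7.1.21–7.1.23 and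
  7.2.1), applied to the `T_e`-definable closure `k* = Dcl_e(k ∪ {αᵢ} ∪ {exp αᵢ : i ∈ s})`, whose
  dimension over `k` is at most `m = |s|` because `ᾱ` is `T_e`-definable from `k` and the
  `exp αᵢ` (den Besten, Claim in the proof of Lemma 7.2.4): *any `m + 1` non-zero elements of
  `k*` satisfy a non-trivial multiplicative relation with integer exponents modulo
  `k^× · (units of the valuation ring of K)`*;
* **(E) an argument about ordered exponential fields** turning (V) into (36) (Wilkie §11;
  den Besten Lemmas 7.2.2, 7.2.3 and p. 98).

This file proves **(E)**, i.e. **9.3 from (V)**, with (V) entering only through its instances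
on the tuples `(Σ νᵢ αᵢ, exp αᵢ (i ∈ s))` — the explicit hypothesis `hval` of
`RealExpModel.lemma93_of_valuationInequality`, a statement about the ordered exponential field `K`,
the embedding `f : k ↪ K` and integers only (no `T_e`, no definable closure and no value group is
needed to *state* it).  Consequently the leaf, Wilkie's theorem, the existential closedness of
models in extensions (`Wilkie1996_realExp_modelsExistentiallyClosed`) and the o-minimality of
`ℝ_exp` all follow from these instances of the valuation inequality
(`Wilkie1996_expPolynomialPoints_bounded_of_valuationInequality`, …).  Nothing here is a new named
fact; what is NOT here is (V) itself (Wilkie §10, resting on the First Main Theorem for `T_e`).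

## The argument (a variant of den Besten's proof of Lemma 7.2.3 that needs no adapted bases)

Write `z ≫ z'` for `N z' < z` for all `N ∈ ℕ`, and call `z ∈ K` *large* if `z > b` for all
`b ∈ k`.  Let `L = {Σ_{i ∈ s} νᵢ αᵢ : ν ∈ ℤˢ}`.

* **Step** (`RealExpModel.ValuationStep.step`).  If `z = Σ νᵢ αᵢ ∈ L` is large, (V) gives
  integers `M, πᵢ` not all zero, `c ∈ k_{>0}` and `N` with `1/N ≤ z^M exp(Σ πᵢ αᵢ) / c ≤ N`.
  If `M = 0`, then `Σ πᵢ αᵢ - log c ∈ [-N, N]`, and adjusting by an integer gives (36).  If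
  `M > 0` (the case `M < 0` is symmetric), then `z' = -Σ πᵢ αᵢ = log(z^M /(unit · c))` is
  again large and in `L`, and `z ≫ z'` because `exp t > A t^M` as soon as `t` is large
  (`A ∈ k`), by `exp t > (t/(M+1))^{M+1}`.
* **Iteration** (`RealExpModel.ValuationStep.chain`).  Starting from `z₀ = ±α_l` we get, unless
  (36) holds, large elements `z₀ ≫ z₁ ≫ ⋯ ≫ z_m` of `L`, `m = |s|`.
* **Rank** (`RealExpModel.ValuationStep.not_chain`).  The coefficient vectors of `z₀, …, z_m`
  are `m + 1` vectors of `ℤˢ`, hence `ℤ`-linearly dependent; but a non-trivial integer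
  combination of `z₀ ≫ ⋯ ≫ z_m > 0` is dominated by its first term and cannot vanish.

## References

* A. J. Wilkie, *Model completeness results for expansions of the ordered field of real numbers by
  restricted Pfaffian functions and the exponential function*, J. Amer. Math. Soc. 9 (1996),
  1051–1094: 9.3 (p. 1084) and its proof, §§10–11. [WilkieJAMS1996]
* M. den Besten, *Wilkie's Theorem and the Uniform Real Schanuel Conjecture*, MSc thesis, Utrecht
  (2016): condition (36) (p. 75), Definitions 7.1.14–7.1.18 (value group, `valdim`),
  Theorem 7.1.23 (valuation inequality), Lemmas 7.2.3–7.2.4 and the derivation of (36) (p. 98).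
  [DenBesten2016]
-/

noncomputable section

open FirstOrder FirstOrder.Language FirstOrder.Language.Structure

namespace Literature.ModelTheory.ExponentialFields

namespace RealExpModel

variable {k K : Language.Theory.ModelType.{0, 0, 0} realExpTheory}

/-! ### Two more exponential facts in a model of `T_exp` -/

/-- `a < exp a` in every model of `T_exp` (transfer of `x < x + 1 ≤ Real.exp x`). [folklore] -/
theorem lt_exp_self (a : K) : a < exp a := by
  have h := realize_sentence_of_real K
    (σ := ∀' (Language.Term.lt (&0) (Language.orderedExpRing.termExp &0)))
    (by
      simp only [Sentence.Realize, Formula.Realize, BoundedFormula.realize_all, Term.realize_lt]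
      intro x
      have hx : x < Real.exp x := (lt_add_one x).trans_le (Real.add_one_le_exp x)
      simpa [Fin.snoc] using hx)
  simp only [Sentence.Realize, Formula.Realize, BoundedFormula.realize_all, Term.realize_lt] at h
  simpa [Fin.snoc] using h a

/-- Polynomial lower bound for the exponential in a model of `T_exp`: for `0 < t`,
`(t / (M+1))^{M+1} < exp t` (from `u < exp u` with `u = t/(M+1)`). [folklore] -/
theorem div_pow_lt_exp {t : K} (ht : 0 < t) (M : ℕ) :
    (t / (M + 1 : K)) ^ (M + 1) < exp t := by
  have hM : (0 : K) < (M + 1 : K) := by exact_mod_cast Nat.succ_pos M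
  have hu : 0 < t / (M + 1 : K) := div_pos ht hM
  have h2 : (t / (M + 1 : K)) ^ (M + 1) < (exp (t / (M + 1 : K))) ^ (M + 1) :=
    pow_lt_pow_left₀ (lt_exp_self _) hu.le (Nat.succ_ne_zero M)
  have h4 : (exp (t / (M + 1 : K))) ^ (M + 1) = exp t := by
    rw [← exp_natCast_mul]
    congr 1
    push_cast
    field_simp
  rwa [h4] at h2

/-- `exp` reflects the strict order. [folklore] -/
theorem lt_of_exp_lt_exp {a b : K} (h : exp a < exp b) : a < b := by
  by_contra hab
  rcases (not_lt.1 hab).lt_or_eq with hba | hba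
  · exact absurd (exp_lt_exp hba) (not_lt.2 h.le)
  · rw [hba] at h; exact lt_irrefl _ h

/-- `exp` is monotone. [folklore] -/
theorem exp_le_exp_of_le {a b : K} (h : a ≤ b) : exp a ≤ exp b := by
  rcases h.lt_or_eq with h | h
  · exact (exp_lt_exp h).le
  · rw [h]

namespace ValuationStep

variable {n : ℕ}

/-! ### Integer combinations of the coordinates -/

/-- The integer combination `Σᵢ (-πᵢ) αᵢ` is `-Σᵢ πᵢ αᵢ`. [folklore] -/
theorem sum_neg_mul (α : Fin n → K) (π : Fin n → ℤ) :
    ∑ i, ((-π) i : K) * α i = -∑ i, (π i : K) * α i := by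
  simp [Finset.sum_neg_distrib]

variable (f : k ↪[Language.orderedExpRing] K)

/-! ### Large elements (`> k`) -/

/-- A large element is positive. [folklore] -/
theorem pos_of_large {z : K} (hz : ∀ b : k, f b < z) : 0 < z := by
  simpa using hz 0

/-- A large element is at least `1`. [folklore] -/
theorem one_le_of_large {z : K} (hz : ∀ b : k, f b < z) : 1 ≤ z := by
  have := hz 1
  rw [RealExpModel.map_one] at this
  exact this.le

/-- If `exp z` exceeds `f (exp b)` for all `b ∈ k` then `z` is large. [folklore] -/
theorem large_of_exp {z : K} (hz : ∀ b : k, f (exp b) < exp z) (b : k) : f b < z := by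
  have := hz b
  rw [map_exp] at this
  exact lt_of_exp_lt_exp this

/-! ### Finite elements: an integer part -/

/-- A discrete intermediate value principle on `ℕ`. [folklore] -/
theorem exists_succ_not {P : ℕ → Prop} (h0 : P 0) {m : ℕ} (hm : ¬ P m) :
    ∃ j < m, P j ∧ ¬ P (j + 1) := by
  induction m with
  | zero => exact absurd h0 hm
  | succ m ih =>
    by_cases hPm : P m
    · exact ⟨m, Nat.lt_succ_self m, hPm, hm⟩
    · obtain ⟨j, hj, hP⟩ := ih hPm
      exact ⟨j, Nat.lt_succ_of_lt hj, hP⟩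

/-- An element of `[-N, N]` lies in `[q, q + 1)` for some integer `q`. [folklore] -/
theorem exists_int_floor {t : K} {N : ℕ} (h1 : -(N : K) ≤ t) (h2 : t ≤ N) :
    ∃ q : ℤ, (q : K) ≤ t ∧ t < q + 1 := by
  have h0 : (-(N : ℤ) : K) + ((0 : ℕ) : K) ≤ t := by simpa using h1
  have hm : ¬ ((-(N : ℤ) : K) + ((2 * N + 1 : ℕ) : K) ≤ t) := by
    push_cast
    intro h
    linarith
  obtain ⟨j, -, hj, hj'⟩ :=
    exists_succ_not (P := fun j : ℕ => (-(N : ℤ) : K) + (j : K) ≤ t) h0 hm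
  refine ⟨-(N : ℤ) + j, by push_cast at hj ⊢; linarith, ?_⟩
  push_cast at hj' ⊢
  linarith [not_le.1 hj']

/-- From a two-sided estimate `exp d ≤ N exp y`, `exp y ≤ N exp d` with `d ∈ k`: there is
`c ∈ k` with `0 < c + y < 1` (den Besten, p. 98: "since `b ∈ Fin(K)` there exists `q ∈ ℚ` such
that `0 < q - b < 1`"). [cite: DenBesten2016, p. 98] -/
theorem exists_add_mem_Ioo {y : K} {d : k} {N : ℕ}
    (h1 : f (exp d) ≤ (N : K) * exp y) (h2 : exp y ≤ (N : K) * f (exp d)) :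
    ∃ c : k, 0 < f c + y ∧ f c + y < 1 := by
  have hN1 : (N : K) < exp (N : K) := lt_exp_self _
  rw [map_exp] at h1 h2
  set t := y - f d with ht
  have hexp_t : exp t = exp y / exp (f d) := by
    rw [ht, sub_eq_add_neg, exp_add, exp_neg', div_eq_mul_inv]
  -- `t ≤ N`
  have ht2 : t ≤ N := by
    by_contra hlt
    push Not at hlt
    have h3 : exp (N : K) < exp t := exp_lt_exp hlt
    rw [hexp_t, lt_div_iff₀ (exp_pos _)] at h3
    have h4 := mul_lt_mul_of_pos_right hN1 (exp_pos (f d))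
    linarith
  -- `-N ≤ t`
  have ht1 : -(N : K) ≤ t := by
    by_contra hlt
    push Not at hlt
    have h3 : exp t < exp (-(N : K)) := exp_lt_exp hlt
    rw [hexp_t, exp_neg', div_lt_iff₀ (exp_pos _)] at h3
    have h5 : exp y * exp (N : K) < exp (f d) := by
      calc exp y * exp (N : K) < (exp (N : K))⁻¹ * exp (f d) * exp (N : K) :=
            mul_lt_mul_of_pos_right h3 (exp_pos _)
        _ = exp (f d) := by
            rw [mul_assoc, mul_comm (exp (f d)), ← mul_assoc, inv_mul_cancel₀ (exp_ne_zero _),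
              one_mul]
    have h6 := mul_lt_mul_of_pos_right hN1 (exp_pos y)
    linarith
  obtain ⟨q, hq1, hq2⟩ := exists_int_floor ht1 ht2
  have htwo : f (2⁻¹ : k) = (2⁻¹ : K) := by
    rw [← coe_toRingHom, map_inv₀, map_ofNat]
  by_cases hhalf : t < q + 2⁻¹
  · refine ⟨-d - q + 2⁻¹, ?_, ?_⟩
    · simp only [map_sub'', RealExpModel.map_add, RealExpModel.map_neg, MsStep.map_intCast', htwo]
      linarith
    · simp only [map_sub'', RealExpModel.map_add, RealExpModel.map_neg, MsStep.map_intCast', htwo]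
      linarith
  · refine ⟨-d - q, ?_, ?_⟩
    · simp only [map_sub'', RealExpModel.map_neg, MsStep.map_intCast']
      push Not at hhalf
      linarith
    · simp only [map_sub'', RealExpModel.map_neg, MsStep.map_intCast']
      linarith

/-! ### The step -/

variable {f} (s : Finset (Fin n)) (α : Fin n → K)

/-- **The step, case `M > 0`.**  If `z = Σ νᵢ αᵢ` is large and
`c ≤ N · z^M exp(Σ πᵢ αᵢ)`, `z^M exp(Σ πᵢ αᵢ) ≤ N c` with `M ≥ 1`, `0 < c ∈ k`, then
`z' = -Σ πᵢ αᵢ` is large and `N' z' < z` for every `N' ∈ ℕ`. [cite: DenBesten2016, Lemma 7.2.3] -/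
theorem step_pos {ν π : Fin n → ℤ} {c : k} {N M : ℕ} (hM : 0 < M)
    (hz : ∀ b : k, f b < (∑ i, (ν i : K) * α i)) (hc : 0 < f c)
    (h1 : f c ≤ (N : K) * ((∑ i, (ν i : K) * α i) ^ M * exp (∑ i, (π i : K) * α i)))
    (h2 : (∑ i, (ν i : K) * α i) ^ M * exp (∑ i, (π i : K) * α i) ≤ (N : K) * f c) :
    (∀ b : k, f b < (∑ i, ((-π) i : K) * α i)) ∧
      ∀ N' : ℕ, (N' : K) * (∑ i, ((-π) i : K) * α i) < (∑ i, (ν i : K) * α i) := by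
  set z := (∑ i, (ν i : K) * α i) with hzdef
  set y := (∑ i, (π i : K) * α i) with hydef
  have hzy : (∑ i, ((-π) i : K) * α i) = -y := sum_neg_mul α π
  rw [hzy]
  have hz0 : 0 < z := pos_of_large f hz
  have hz1 : 1 ≤ z := one_le_of_large f hz
  have hzM : z ≤ z ^ M := by
    calc z = z ^ 1 := (pow_one z).symm
      _ ≤ z ^ M := pow_le_pow_right₀ hz1 hM
  have hzMpos : 0 < z ^ M := pow_pos hz0 M
  have hNpos : (0 : K) < N := by
    rcases Nat.eq_zero_or_pos N with rfl | hN
    · simp only [Nat.cast_zero, zero_mul] at h2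
      exact absurd h2 (not_le.2 (mul_pos hzMpos (exp_pos y)))
    · exact_mod_cast hN
  -- `exp (-y) = z^M / (z^M exp y)` is squeezed between `z^M/(N c)` and `N z^M / c`
  have hey : exp (-y) * (z ^ M * exp y) = z ^ M := by
    rw [exp_neg', mul_comm, mul_assoc, mul_inv_cancel₀ (exp_ne_zero y), mul_one]
  have hlow : z ^ M ≤ (N : K) * f c * exp (-y) := by
    have := mul_le_mul_of_nonneg_right h2 (exp_pos (-y)).le
    rw [mul_comm (z ^ M * exp y), hey] at this
    linarith
  have hup : f c * exp (-y) ≤ (N : K) * z ^ M := by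
    have := mul_le_mul_of_nonneg_right h1 (exp_pos (-y)).le
    rw [mul_assoc, mul_comm (z ^ M * exp y), hey] at this
    exact this
  constructor
  · -- `-y` is large: `N · f c · f (exp b) < z ≤ z^M ≤ N f c exp(-y)`
    refine large_of_exp f fun b => ?_
    have hb : f (N * c * exp b) < z := hz _
    rw [RealExpModel.map_mul, RealExpModel.map_mul, MsStep.map_natCast'] at hb
    have h3 : (N : K) * f c * f (exp b) < (N : K) * f c * exp (-y) := by linarith
    exact lt_of_mul_lt_mul_left h3 (mul_pos hNpos hc).le
  · intro N'
    by_contra hcon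
    push Not at hcon
    -- `t = z / N'` is large, `t ≤ -y`, so `f c · exp t ≤ N z^M = N N'^M t^M`
    have hN'pos : (0 : K) < N' := by
      rcases Nat.eq_zero_or_pos N' with rfl | hN'
      · simp only [Nat.cast_zero, zero_mul] at hcon
        exact absurd hcon (not_le.2 hz0)
      · exact_mod_cast hN'
    set t := z / (N' : K) with htdef
    have hzt : z = (N' : K) * t := by rw [htdef]; field_simp
    have ht_large : ∀ b : k, f b < t := fun b => by
      have hb : f (N' * b) < z := hz _
      rw [RealExpModel.map_mul, MsStep.map_natCast', hzt] at hb
      exact lt_of_mul_lt_mul_left hb hN'pos.le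
    have ht0 : 0 < t := pos_of_large f ht_large
    have hty : t ≤ -y := by
      rw [hzt] at hcon
      exact le_of_mul_le_mul_left hcon hN'pos
    have h4 : f c * exp t ≤ (N : K) * ((N' : K) ^ M * t ^ M) := by
      calc f c * exp t ≤ f c * exp (-y) := mul_le_mul_of_nonneg_left (exp_le_exp_of_le hty) hc.le
        _ ≤ (N : K) * z ^ M := hup
        _ = (N : K) * ((N' : K) ^ M * t ^ M) := by rw [hzt, mul_pow]
    -- the polynomial lower bound `(t/(M+1))^{M+1} < exp t`
    have h5 : (t / (M + 1 : K)) ^ (M + 1) < exp t := div_pow_lt_exp ht0 M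
    have hM1 : (0 : K) < (M + 1 : K) := by exact_mod_cast Nat.succ_pos M
    have hD : (0 : K) < (M + 1 : K) ^ (M + 1) := pow_pos hM1 _
    have h6 : f c * (t / (M + 1 : K)) ^ (M + 1) < (N : K) * ((N' : K) ^ M * t ^ M) :=
      lt_of_lt_of_le (mul_lt_mul_of_pos_left h5 hc) h4
    rw [div_pow, mul_div_assoc', div_lt_iff₀ hD, pow_succ] at h6
    have htM : 0 < t ^ M := pow_pos ht0 M
    have h7 : f c * t < (N : K) * (N' : K) ^ M * (M + 1 : K) ^ (M + 1) := by
      have h8 : (f c * t) * t ^ M < ((N : K) * (N' : K) ^ M * (M + 1 : K) ^ (M + 1)) * t ^ M := by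
        calc (f c * t) * t ^ M = f c * (t ^ M * t) := by ring
          _ < (N : K) * ((N' : K) ^ M * t ^ M) * (M + 1 : K) ^ (M + 1) := h6
          _ = ((N : K) * (N' : K) ^ M * (M + 1 : K) ^ (M + 1)) * t ^ M := by ring
      exact lt_of_mul_lt_mul_right h8 htM.le
    -- the element `N N'^M (M+1)^{M+1} / c` of `k` bounds the large `t`: contradiction
    have h9 : t < f ((N : k) * (N' : k) ^ M * ((M : k) + 1) ^ (M + 1) / c) := by
      rw [← coe_toRingHom]
      simp only [map_div₀, _root_.map_mul, _root_.map_pow, _root_.map_natCast, _root_.map_add,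
        _root_.map_one]
      rw [coe_toRingHom, lt_div_iff₀ hc]
      linarith
    exact absurd h9 (not_lt.2 (ht_large _).le)

/-- **The step.**  If `z = Σ νᵢ αᵢ` is large, then the instance of the valuation inequality at
`(z, exp αᵢ (i ∈ s))` yields either condition (36), or a large `z' = Σ ν'ᵢ αᵢ` (with `ν'`
supported in `s`) with `z ≫ z'`. [cite: DenBesten2016, Lemma 7.2.3] -/
theorem step {ν : Fin n → ℤ} (hz : ∀ b : k, f b < (∑ i, (ν i : K) * α i))
    (hvalν : ∃ (M : ℤ) (π : Fin n → ℤ) (c : k) (N : ℕ), (∀ i, i ∉ s → π i = 0) ∧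
        (M ≠ 0 ∨ ∃ i, π i ≠ 0) ∧ 0 < f c ∧
        f c ≤ (N : K) * ((∑ i, (ν i : K) * α i) ^ M * exp (∑ i, (π i : K) * α i)) ∧
        (∑ i, (ν i : K) * α i) ^ M * exp (∑ i, (π i : K) * α i) ≤ (N : K) * f c) :
    (∃ (μ : Fin n → ℤ) (c : k), (∀ i, i ∉ s → μ i = 0) ∧ (∃ i, μ i ≠ 0) ∧
        0 < f c + (∑ i, (μ i : K) * α i) ∧ f c + (∑ i, (μ i : K) * α i) < 1) ∨
      ∃ ν' : Fin n → ℤ, (∀ i, i ∉ s → ν' i = 0) ∧ (∀ b : k, f b < (∑ i, (ν' i : K) * α i)) ∧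
        ∀ N' : ℕ, (N' : K) * (∑ i, (ν' i : K) * α i) < (∑ i, (ν i : K) * α i) := by
  obtain ⟨M, π, c, N, hπ, hMπ, hc, h1, h2⟩ := hvalν
  have hck : 0 < c := (map_lt_iff f 0 c).1 (by rwa [RealExpModel.map_zero])
  rcases lt_trichotomy M 0 with hM | rfl | hM
  · -- `M < 0`: pass to `(-M, -π, c⁻¹)`
    right
    set M' : ℕ := (-M).toNat with hM'
    have hMM'0 : ((M' : ℕ) : ℤ) = -M := by rw [hM']; exact Int.toNat_of_nonneg (by omega)
    have hMM' : M = -(M' : ℤ) := by omega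
    have hM'pos : 0 < M' := by omega
    have hx : 0 < (∑ i, (ν i : K) * α i) ^ M * exp (∑ i, (π i : K) * α i) :=
      mul_pos (zpow_pos (pos_of_large f hz) M) (exp_pos _)
    have hrew : ((∑ i, (ν i : K) * α i) ^ M * exp (∑ i, (π i : K) * α i))⁻¹ =
        (∑ i, (ν i : K) * α i) ^ M' * exp (∑ i, ((-π) i : K) * α i) := by
      rw [sum_neg_mul, exp_neg', mul_inv, hMM', zpow_neg, inv_inv, zpow_natCast]
    have hfinv : f c⁻¹ = (f c)⁻¹ := by rw [← coe_toRingHom, map_inv₀]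
    have hc' : 0 < f c⁻¹ := by rw [hfinv]; exact inv_pos.2 hc
    have h1' : f c⁻¹ ≤
        (N : K) * ((∑ i, (ν i : K) * α i) ^ M' * exp (∑ i, ((-π) i : K) * α i)) := by
      rw [← hrew, hfinv, ← div_eq_mul_inv, le_div_iff₀ hx]
      calc (f c)⁻¹ * ((∑ i, (ν i : K) * α i) ^ M * exp (∑ i, (π i : K) * α i))
          ≤ (f c)⁻¹ * ((N : K) * f c) := mul_le_mul_of_nonneg_left h2 (inv_pos.2 hc).le
        _ = N := by field_simp
    have h2' :
        (∑ i, (ν i : K) * α i) ^ M' * exp (∑ i, ((-π) i : K) * α i) ≤ (N : K) * f c⁻¹ := by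
      rw [← hrew, hfinv, inv_le_iff_one_le_mul₀' hx]
      calc (1 : K) = f c * (f c)⁻¹ := by field_simp
        _ ≤ ((N : K) * ((∑ i, (ν i : K) * α i) ^ M * exp (∑ i, (π i : K) * α i))) *
              (f c)⁻¹ :=
            mul_le_mul_of_nonneg_right h1 (inv_pos.2 hc).le
        _ = (∑ i, (ν i : K) * α i) ^ M * exp (∑ i, (π i : K) * α i) *
              ((N : K) * (f c)⁻¹) := by ring
    obtain ⟨hl, hd⟩ := step_pos (f := f) α hM'pos hz hc' h1' h2'
    exact ⟨-(-π), fun i hi => by simp [hπ i hi], hl, hd⟩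
  · -- `M = 0`: condition (36)
    left
    simp only [zpow_zero, one_mul] at h1 h2
    have hπ0 : ∃ i, π i ≠ 0 := by
      rcases hMπ with h | h
      · exact absurd rfl h
      · exact h
    obtain ⟨d, hd⟩ := exists_exp_eq hck
    rw [← hd] at h1 h2
    obtain ⟨c', hc'1, hc'2⟩ := exists_add_mem_Ioo f h1 h2
    exact ⟨π, c', hπ, hπ0, hc'1, hc'2⟩
  · -- `M > 0`
    right
    set M' : ℕ := M.toNat with hM'
    have hMM' : M = (M' : ℤ) := by rw [hM', Int.toNat_of_nonneg hM.le]
    have hM'pos : 0 < M' := by omega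
    rw [hMM', zpow_natCast] at h1 h2
    obtain ⟨hl, hd⟩ := step_pos (f := f) α hM'pos hz hc h1 h2
    exact ⟨-π, fun i hi => by simp [hπ i hi], hl, hd⟩

/-! ### The iteration -/

/-- **The iteration.**  Under the valuation hypothesis for all large `Σ νᵢ αᵢ` (`ν` supported in
`s`), and given a large `|α_l|`, `l ∈ s`: either condition (36) holds, or for every `t` there is
a chain `z₀ ≫ z₁ ≫ ⋯ ≫ z_t` of large integer combinations of the `αᵢ`, `i ∈ s`.
[cite: DenBesten2016, Lemma 7.2.3] -/
theorem chain
    (hval : ∀ ν : Fin n → ℤ, (∀ i, i ∉ s → ν i = 0) → (∀ b : k, f b < (∑ i, (ν i : K) * α i)) →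
      ∃ (M : ℤ) (π : Fin n → ℤ) (c : k) (N : ℕ), (∀ i, i ∉ s → π i = 0) ∧
        (M ≠ 0 ∨ ∃ i, π i ≠ 0) ∧ 0 < f c ∧
        f c ≤ (N : K) * ((∑ i, (ν i : K) * α i) ^ M * exp (∑ i, (π i : K) * α i)) ∧
        (∑ i, (ν i : K) * α i) ^ M * exp (∑ i, (π i : K) * α i) ≤ (N : K) * f c)
    (l : Fin n) (hl : l ∈ s) (hlt : ∀ b : k, f b < |α l|) (t : ℕ) :
    (∃ (μ : Fin n → ℤ) (c : k), (∀ i, i ∉ s → μ i = 0) ∧ (∃ i, μ i ≠ 0) ∧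
        0 < f c + (∑ i, (μ i : K) * α i) ∧ f c + (∑ i, (μ i : K) * α i) < 1) ∨
      ∃ Q : ℕ → (Fin n → ℤ), (∀ j ≤ t, ∀ i, i ∉ s → Q j i = 0) ∧
        (∀ j ≤ t, ∀ b : k, f b < (∑ i, ((Q j) i : K) * α i)) ∧
        ∀ j j', j < j' → j' ≤ t →
          ∀ N' : ℕ, (N' : K) * (∑ i, ((Q j') i : K) * α i) < (∑ i, ((Q j) i : K) * α i) := by
  classical
  induction t with
  | zero =>
    -- `z₀ = ± α_l`
    right
    have key : ∀ σ : ℤ, (∑ i, ((Pi.single l σ : Fin n → ℤ) i : K) * α i) = (σ : K) * α l := by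
      intro σ
      rw [Finset.sum_eq_single l (fun i _ hi => by simp [hi]) (by simp)]
      simp
    have hsupp : ∀ σ : ℤ, ∀ i, i ∉ s → (Pi.single l σ : Fin n → ℤ) i = 0 := by
      intro σ i hi
      have : i ≠ l := fun h => hi (h ▸ hl)
      simp [this]
    rcases le_or_gt 0 (α l) with h0 | h0
    · refine ⟨fun _ => Pi.single l 1, fun j _ i hi => hsupp 1 i hi, fun j _ b => ?_,
        fun j j' hjj' hj' => ?_⟩
      · show f b < (∑ i, ((Pi.single l 1 : Fin n → ℤ) i : K) * α i)
        rw [key 1]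
        simpa [abs_of_nonneg h0] using hlt b
      · omega
    · refine ⟨fun _ => Pi.single l (-1), fun j _ i hi => hsupp (-1) i hi, fun j _ b => ?_,
        fun j j' hjj' hj' => ?_⟩
      · show f b < (∑ i, ((Pi.single l (-1) : Fin n → ℤ) i : K) * α i)
        rw [key (-1)]
        simpa [abs_of_neg h0] using hlt b
      · omega
  | succ t ih =>
    rcases ih with h | ⟨Q, hQs, hQl, hQd⟩
    · exact Or.inl h
    · rcases step s α (hQl t le_rfl) (hval _ (hQs t le_rfl) (hQl t le_rfl)) with
        h | ⟨ν', hν's, hν'l, hν'd⟩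
      · exact Or.inl h
      · right
        refine ⟨fun j => if j ≤ t then Q j else ν', fun j hj i hi => ?_, fun j hj b => ?_,
          fun j j' hjj' hj' N' => ?_⟩
        · by_cases hjt : j ≤ t
          · simp only [hjt, if_true]; exact hQs j hjt i hi
          · simp only [hjt, if_false]; exact hν's i hi
        · by_cases hjt : j ≤ t
          · simp only [hjt, if_true]; exact hQl j hjt b
          · simp only [hjt, if_false]; exact hν'l b
        · have hjt : j ≤ t := by omega
          by_cases hj't : j' ≤ t
          · simp only [hjt, hj't, if_true]; exact hQd j j' hjj' hj't N'
          · simp only [hjt, hj't, if_true, if_false]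
            -- `N' z' < z_t ≤ z_j`
            refine lt_of_lt_of_le (hν'd N') ?_
            rcases Nat.lt_or_eq_of_le hjt with hlt' | rfl
            · have := hQd j t hlt' le_rfl 1
              simp only [Nat.cast_one, one_mul] at this
              exact this.le
            · exact le_rfl

/-! ### The rank argument -/

/-- **No long chains**: there is no chain `z₀ ≫ z₁ ≫ ⋯ ≫ z_m > 0` of integer combinations of
the `αᵢ`, `i ∈ s`, of length `m + 1 > |s|` — the `m + 1` coefficient vectors in `ℤˢ` are
linearly dependent, and a non-trivial integer relation is dominated by its first term.
[folklore] -/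
theorem not_chain {Q : ℕ → (Fin n → ℤ)} (hQs : ∀ j ≤ s.card, ∀ i, i ∉ s → Q j i = 0)
    (hQp : ∀ j ≤ s.card, 0 < (∑ i, ((Q j) i : K) * α i))
    (hQd : ∀ j j', j < j' → j' ≤ s.card → ∀ N' : ℕ,
      (N' : K) * (∑ i, ((Q j') i : K) * α i) < (∑ i, ((Q j) i : K) * α i)) :
    False := by
  classical
  set m := s.card with hm
  have hjm : ∀ j : Fin (m + 1), (j : ℕ) ≤ m := fun j => Nat.lt_succ_iff.1 j.is_lt
  have hQp' : ∀ j : Fin (m + 1), 0 < (∑ i, ((Q j) i : K) * α i) := fun j => hQp j (hjm j)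
  -- the `m + 1` coefficient vectors restricted to `s` are linearly dependent over `ℤ`
  let R : Fin (m + 1) → (s → ℤ) := fun j i => Q j i
  have hdep : ¬ LinearIndependent ℤ R := by
    intro hli
    have := hli.fintype_card_le_finrank
    rw [Module.finrank_fintype_fun_eq_card, Fintype.card_coe, Fintype.card_fin] at this
    omega
  obtain ⟨g, hg0, j₁, hj₁⟩ := Fintype.not_linearIndependent_iff.1 hdep
  have hrel : ∀ i, ∑ j : Fin (m + 1), g j * Q j i = 0 := by
    intro i
    by_cases hi : i ∈ s
    · have := congr_fun hg0 ⟨i, hi⟩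
      simpa [R, Finset.sum_apply, smul_eq_mul] using this
    · exact Finset.sum_eq_zero fun j _ => by rw [hQs j (hjm j) i hi, mul_zero]
  -- hence `Σ_j g_j z_j = 0`
  have hzero : ∑ j : Fin (m + 1), (g j : K) * (∑ i, ((Q j) i : K) * α i) = 0 := by
    calc ∑ j : Fin (m + 1), (g j : K) * (∑ i, ((Q j) i : K) * α i)
        = ∑ j : Fin (m + 1), ∑ i, (g j : K) * ((Q j i : K) * α i) := by
          refine Finset.sum_congr rfl fun j _ => ?_
          rw [Finset.mul_sum]
      _ = ∑ i, (∑ j : Fin (m + 1), (g j : K) * (Q j i : K)) * α i := by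
          rw [Finset.sum_comm]
          refine Finset.sum_congr rfl fun i _ => ?_
          rw [Finset.sum_mul]
          refine Finset.sum_congr rfl fun j _ => ?_
          ring
      _ = 0 := by
          refine Finset.sum_eq_zero fun i _ => ?_
          have h := congrArg (fun x : ℤ => (x : K)) (hrel i)
          push_cast at h
          rw [h, zero_mul]
  -- the first index `j₀` with `g_{j₀} ≠ 0`
  let S : Finset (Fin (m + 1)) := Finset.univ.filter fun j => g j ≠ 0
  have hSne : S.Nonempty := ⟨j₁, by simp [S, hj₁]⟩
  set j₀ := S.min' hSne with hj₀
  have hj₀S : j₀ ∈ S := Finset.min'_mem S hSne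
  have hgj₀ : g j₀ ≠ 0 := by simpa [S] using hj₀S
  have hbefore : ∀ j : Fin (m + 1), j < j₀ → g j = 0 := by
    intro j hj
    by_contra h
    have : j₀ ≤ j := Finset.min'_le S j (by simp [S, h])
    exact absurd hj (not_lt.2 this)
  -- split the vanishing sum at `j₀`: head + tail over `T = {j | j₀ < j}`
  let T : Finset (Fin (m + 1)) := Finset.univ.filter fun j => j₀ < j
  have hsplit : (g j₀ : K) * (∑ i, ((Q j₀) i : K) * α i) +
      ∑ j ∈ T, (g j : K) * (∑ i, ((Q j) i : K) * α i) = 0 := by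
    have h1 : ∑ j : Fin (m + 1), (g j : K) * (∑ i, ((Q j) i : K) * α i) =
        ∑ j ∈ Finset.univ.filter (fun j => j₀ ≤ j), (g j : K) * (∑ i, ((Q j) i : K) * α i) := by
      rw [Finset.sum_filter]
      refine Finset.sum_congr rfl fun j _ => ?_
      by_cases h : j₀ ≤ j
      · simp [h]
      · simp [hbefore j (not_le.1 h)]
    have h2 : Finset.univ.filter (fun j : Fin (m + 1) => j₀ ≤ j) = insert j₀ T := by
      ext j
      simp only [Finset.mem_filter, Finset.mem_univ, true_and, Finset.mem_insert, T]
      constructor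
      · intro h; exact (eq_or_lt_of_le h).imp Eq.symm _root_.id
      · rintro (rfl | h); exacts [le_rfl, h.le]
    have h3 : j₀ ∉ T := by simp [T]
    have h4 := hzero
    rw [h1, h2, Finset.sum_insert h3] at h4
    exact h4
  -- bound the tail: each term is at most `z_{j₀} / (m + 1)` in absolute value
  set G : ℕ := ∑ j, (g j).natAbs with hG
  have hgle : ∀ j, |(g j : K)| ≤ G := by
    intro j
    have : (g j).natAbs ≤ G := by
      rw [hG]
      exact Finset.single_le_sum (f := fun j => (g j).natAbs) (fun _ _ => Nat.zero_le _)
        (Finset.mem_univ j)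
    calc |(g j : K)| = ((g j).natAbs : K) := by
            rw [← Int.cast_abs, Int.abs_eq_natAbs, Int.cast_natCast]
      _ ≤ G := by exact_mod_cast this
  have hm1 : (0 : K) < (m + 1 : K) := by exact_mod_cast Nat.succ_pos m
  have htail : ∀ j ∈ T,
      |(g j : K) * (∑ i, ((Q j) i : K) * α i)| ≤ (∑ i, ((Q j₀) i : K) * α i) / (m + 1 : K) := by
    intro j hj
    have hjj : j₀ < j := by simpa [T] using hj
    have hd := hQd j₀ j hjj (hjm j) ((m + 1) * G)
    push_cast at hd
    rw [abs_mul, abs_of_pos (hQp' j), le_div_iff₀ hm1]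
    calc |(g j : K)| * (∑ i, ((Q j) i : K) * α i) * (m + 1 : K)
        ≤ (G : K) * (∑ i, ((Q j) i : K) * α i) * (m + 1 : K) :=
          mul_le_mul_of_nonneg_right (mul_le_mul_of_nonneg_right (hgle j) (hQp' j).le) hm1.le
      _ = ((m : K) + 1) * (G : K) * (∑ i, ((Q j) i : K) * α i) := by ring
      _ ≤ (∑ i, ((Q j₀) i : K) * α i) := hd.le
  have hTcard : (T.card : K) ≤ m := by
    have : T.card < m + 1 := by
      calc T.card < (Finset.univ : Finset (Fin (m + 1))).card :=
            Finset.card_lt_card ⟨Finset.filter_subset _ _, fun h => by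
              have := h (Finset.mem_univ j₀); simp [T] at this⟩
        _ = m + 1 := by simp
    exact_mod_cast Nat.lt_succ_iff.1 this
  have hsum :
      |∑ j ∈ T, (g j : K) * (∑ i, ((Q j) i : K) * α i)| < (∑ i, ((Q j₀) i : K) * α i) := by
    calc |∑ j ∈ T, (g j : K) * (∑ i, ((Q j) i : K) * α i)|
        ≤ ∑ j ∈ T, |(g j : K) * (∑ i, ((Q j) i : K) * α i)| := Finset.abs_sum_le_sum_abs _ _
      _ ≤ ∑ j ∈ T, (∑ i, ((Q j₀) i : K) * α i) / (m + 1 : K) := Finset.sum_le_sum htail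
      _ = T.card * ((∑ i, ((Q j₀) i : K) * α i) / (m + 1 : K)) := by
          rw [Finset.sum_const, nsmul_eq_mul]
      _ ≤ m * ((∑ i, ((Q j₀) i : K) * α i) / (m + 1 : K)) :=
          mul_le_mul_of_nonneg_right hTcard (div_nonneg (hQp' j₀).le hm1.le)
      _ < (∑ i, ((Q j₀) i : K) * α i) := by
          rw [mul_div_assoc', div_lt_iff₀ hm1]
          nlinarith [hQp' j₀]
  -- but the head is at least `z_{j₀}` in absolute value
  have hhead :
      (∑ i, ((Q j₀) i : K) * α i) ≤ |(g j₀ : K) * (∑ i, ((Q j₀) i : K) * α i)| := by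
    rw [abs_mul, abs_of_pos (hQp' j₀)]
    have : (1 : K) ≤ |(g j₀ : K)| := by
      rw [← Int.cast_abs]; exact_mod_cast Int.one_le_abs hgj₀
    nlinarith [hQp' j₀]
  have : (g j₀ : K) * (∑ i, ((Q j₀) i : K) * α i) =
      -∑ j ∈ T, (g j : K) * (∑ i, ((Q j) i : K) * α i) :=
    eq_neg_of_add_eq_zero_left hsplit
  rw [this, abs_neg] at hhead
  exact absurd (lt_of_le_of_lt hhead hsum) (lt_irrefl _)

end ValuationStep

/-! ### 9.3 from the valuation inequality -/

section Lemma93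

variable (f : k ↪[Language.orderedExpRing] K) {n : ℕ}

open ValuationStep in
/-- **Wilkie 1996, 9.3 (p. 1084) from the valuation inequality (§§10–11; den Besten 2016,
Lemmas 7.2.3–7.2.4 and p. 98).**  Let `k ⊆ K` be models of `T_exp`, `ᾱ ∈ Kⁿ`, `s` a set of
indices, `l ∈ s` with `|α_l| > b` for all `b ∈ k`.  Assume the instances of the valuation
inequality `valdim_k(k*) ≤ |s|` (hypothesis `hval`): whenever `z = Σ_{i ∈ s} νᵢ αᵢ` exceeds `k`,
the `|s| + 1` elements `z, exp αᵢ (i ∈ s)` satisfy a non-trivial multiplicative relation with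
integer exponents, `z^M · exp(Σ_{i ∈ s} πᵢ αᵢ) = c · u` with `c ∈ k` and `u` a unit of the
valuation ring of `K` (`c ≤ N · z^M exp(…)` and `z^M exp(…) ≤ N · c`).  Then there are integers
`nᵢ` (`i ∈ s`), not all zero, and `c ∈ k` with `0 < c + Σ_{i ∈ s} nᵢ αᵢ < 1`.
[cite: WilkieJAMS1996, 9.3 (p. 1084) and §§10–11] -/
theorem lemma93_of_valuationInequality (s : Finset (Fin n)) (α : Fin n → K)
    (hval : ∀ ν : Fin n → ℤ, (∀ i, i ∉ s → ν i = 0) → (∀ b : k, f b < ∑ i, (ν i : K) * α i) →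
      ∃ (M : ℤ) (π : Fin n → ℤ) (c : k) (N : ℕ), (∀ i, i ∉ s → π i = 0) ∧
        (M ≠ 0 ∨ ∃ i, π i ≠ 0) ∧ 0 < f c ∧
        f c ≤ (N : K) * ((∑ i, (ν i : K) * α i) ^ M * exp (∑ i, (π i : K) * α i)) ∧
        (∑ i, (ν i : K) * α i) ^ M * exp (∑ i, (π i : K) * α i) ≤ (N : K) * f c)
    (l : Fin n) (hl : l ∈ s) (hlt : ∀ b : k, f b < |α l|) :
    ∃ (ν : Fin n → ℤ) (c : k), (∀ i, i ∉ s → ν i = 0) ∧ (∃ i, ν i ≠ 0) ∧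
      0 < f c + ∑ i, (ν i : K) * α i ∧ f c + ∑ i, (ν i : K) * α i < 1 := by
  have hval' : ∀ ν : Fin n → ℤ, (∀ i, i ∉ s → ν i = 0) → (∀ b : k, f b < (∑ i, (ν i : K) * α i)) →
      ∃ (M : ℤ) (π : Fin n → ℤ) (c : k) (N : ℕ), (∀ i, i ∉ s → π i = 0) ∧
        (M ≠ 0 ∨ ∃ i, π i ≠ 0) ∧ 0 < f c ∧
        f c ≤ (N : K) * ((∑ i, (ν i : K) * α i) ^ M * exp (∑ i, (π i : K) * α i)) ∧
        (∑ i, (ν i : K) * α i) ^ M * exp (∑ i, (π i : K) * α i) ≤ (N : K) * f c :=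
    fun ν hν hz => hval ν hν hz
  rcases ValuationStep.chain (f := f) s α hval' l hl hlt s.card with
    ⟨μ, c, hμ, hμ0, h1, h2⟩ | ⟨Q, hQs, hQl, hQd⟩
  · exact ⟨μ, c, hμ, hμ0, h1, h2⟩
  · exact (ValuationStep.not_chain s α hQs (fun j hj => pos_of_large f (hQl j hj)) hQd).elim

end Lemma93

end RealExpModel

/-! ### The leaf, Wilkie's theorem and its corollaries from the valuation inequality -/

open RealExpModel in
/-- **The boundedness of exponential-polynomial points (`Wilkie1996_expPolynomialPoints_bounded`,
Wilkie 1996, §9) from the instances of the valuation inequality alone**: for all pairs of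
models `k ⊆ K` of `T_exp` and every non-singular zero `ᾱ ∈ Kⁿ` of a square system from `Mˢₙ`,
whenever `z = Σ_{i ∈ s} νᵢ αᵢ > k`, the elements `z, exp αᵢ (i ∈ s)` satisfy a non-trivial
multiplicative integer relation modulo `k^× ·` units (Wilkie §10: the valuation inequality for
`T_e`, applied to `Dcl_e(k, ᾱ, exp ᾱ_s)`; den Besten Theorem 7.1.23 and the Claim in the proof
of Lemma 7.2.4) — through `lemma93_of_valuationInequality` and the induction of §9
(`Wilkie1996_expPolynomialPoints_bounded_of_lemma93`). [cite: WilkieJAMS1996, §§9–11] -/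
theorem Wilkie1996_expPolynomialPoints_bounded_of_valuationInequality
    (hval : ∀ (k K : Language.Theory.ModelType.{0, 0, 0} realExpTheory)
      (f : k ↪[Language.orderedExpRing] K) (n : ℕ) (s : Finset (Fin n))
      (P : Fin n → MvPolynomial (MsVar n) k) (α : Fin n → K),
      IsMsZero f s P α → ∀ ν : Fin n → ℤ, (∀ i, i ∉ s → ν i = 0) →
        (∀ b : k, f b < ∑ i, (ν i : K) * α i) →
        ∃ (M : ℤ) (π : Fin n → ℤ) (c : k) (N : ℕ), (∀ i, i ∉ s → π i = 0) ∧
          (M ≠ 0 ∨ ∃ i, π i ≠ 0) ∧ 0 < f c ∧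
          f c ≤ (N : K) * ((∑ i, (ν i : K) * α i) ^ M * exp (∑ i, (π i : K) * α i)) ∧
          (∑ i, (ν i : K) * α i) ^ M * exp (∑ i, (π i : K) * α i) ≤ (N : K) * f c) :
    Wilkie1996_expPolynomialPoints_bounded :=
  Wilkie1996_expPolynomialPoints_bounded_of_lemma93 fun k K f n s P α h l hl hlt =>
    lemma93_of_valuationInequality f s α (hval k K f n s P α h) l hl hlt

open RealExpModel in
/-- **Wilkie's theorem from the valuation inequality**: the model completeness of `T_exp`
(`wilkie_isModelComplete`) follows from the instances of the valuation inequality for `T_e`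
(Wilkie 1996, Second Main Theorem; §§9–11). [cite: WilkieJAMS1996, Second Main Theorem and §§9–11] -/
theorem wilkie_isModelComplete_of_valuationInequality
    (hval : ∀ (k K : Language.Theory.ModelType.{0, 0, 0} realExpTheory)
      (f : k ↪[Language.orderedExpRing] K) (n : ℕ) (s : Finset (Fin n))
      (P : Fin n → MvPolynomial (MsVar n) k) (α : Fin n → K),
      IsMsZero f s P α → ∀ ν : Fin n → ℤ, (∀ i, i ∉ s → ν i = 0) →
        (∀ b : k, f b < ∑ i, (ν i : K) * α i) →
        ∃ (M : ℤ) (π : Fin n → ℤ) (c : k) (N : ℕ), (∀ i, i ∉ s → π i = 0) ∧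
          (M ≠ 0 ∨ ∃ i, π i ≠ 0) ∧ 0 < f c ∧
          f c ≤ (N : K) * ((∑ i, (ν i : K) * α i) ^ M * exp (∑ i, (π i : K) * α i)) ∧
          (∑ i, (ν i : K) * α i) ^ M * exp (∑ i, (π i : K) * α i) ≤ (N : K) * f c) :
    wilkie_isModelComplete :=
  wilkie_isModelComplete_of_expPolynomialPoints_bounded
    (Wilkie1996_expPolynomialPoints_bounded_of_valuationInequality hval)

open RealExpModel in
/-- **The models of `T_exp` are existentially closed in one another
(`Wilkie1996_realExp_modelsExistentiallyClosed`, Wilkie 1996, §9, p. 1083) from the valuation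
inequality**, through `Wilkie1996_realExp_modelsExistentiallyClosed_of_expPolynomialPoints_bounded`.
[cite: WilkieJAMS1996, §9 (p. 1083) and §§10–11] -/
theorem Wilkie1996_realExp_modelsExistentiallyClosed_of_valuationInequality
    (hval : ∀ (k K : Language.Theory.ModelType.{0, 0, 0} realExpTheory)
      (f : k ↪[Language.orderedExpRing] K) (n : ℕ) (s : Finset (Fin n))
      (P : Fin n → MvPolynomial (MsVar n) k) (α : Fin n → K),
      IsMsZero f s P α → ∀ ν : Fin n → ℤ, (∀ i, i ∉ s → ν i = 0) →
        (∀ b : k, f b < ∑ i, (ν i : K) * α i) →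
        ∃ (M : ℤ) (π : Fin n → ℤ) (c : k) (N : ℕ), (∀ i, i ∉ s → π i = 0) ∧
          (M ≠ 0 ∨ ∃ i, π i ≠ 0) ∧ 0 < f c ∧
          f c ≤ (N : K) * ((∑ i, (ν i : K) * α i) ^ M * exp (∑ i, (π i : K) * α i)) ∧
          (∑ i, (ν i : K) * α i) ^ M * exp (∑ i, (π i : K) * α i) ≤ (N : K) * f c) :
    Wilkie1996_realExp_modelsExistentiallyClosed :=
  Wilkie1996_realExp_modelsExistentiallyClosed_of_expPolynomialPoints_bounded
    (Wilkie1996_expPolynomialPoints_bounded_of_valuationInequality hval)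

open RealExpModel in
/-- **O-minimality of `ℝ_exp` from the valuation inequality** (`wilkie_isOMinimal`, through
`wilkie_isOMinimal_of_expPolynomialPoints_bounded`). [cite: WilkieJAMS1996, Second Main Theorem and §§9–11] -/
theorem wilkie_isOMinimal_of_valuationInequality
    (hval : ∀ (k K : Language.Theory.ModelType.{0, 0, 0} realExpTheory)
      (f : k ↪[Language.orderedExpRing] K) (n : ℕ) (s : Finset (Fin n))
      (P : Fin n → MvPolynomial (MsVar n) k) (α : Fin n → K),
      IsMsZero f s P α → ∀ ν : Fin n → ℤ, (∀ i, i ∉ s → ν i = 0) →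
        (∀ b : k, f b < ∑ i, (ν i : K) * α i) →
        ∃ (M : ℤ) (π : Fin n → ℤ) (c : k) (N : ℕ), (∀ i, i ∉ s → π i = 0) ∧
          (M ≠ 0 ∨ ∃ i, π i ≠ 0) ∧ 0 < f c ∧
          f c ≤ (N : K) * ((∑ i, (ν i : K) * α i) ^ M * exp (∑ i, (π i : K) * α i)) ∧
          (∑ i, (ν i : K) * α i) ^ M * exp (∑ i, (π i : K) * α i) ≤ (N : K) * f c) :
    wilkie_isOMinimal :=
  wilkie_isOMinimal_of_expPolynomialPoints_bounded
    (Wilkie1996_expPolynomialPoints_bounded_of_valuationInequality hval)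

end Literature.ModelTheory.ExponentialFields
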